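import Literature.Analysis.FunctionSpaces.TimePartitionIncrements
import HarnessLib

/-!
# `L³(0,T)`-Cauchy sequences from controlled increments and convergent cell averages

Analysis/FunctionSpaces support file (theorem-only). The time-direction half of the
Aubin–Lions–Simon compactness theorem with a merely `L¹(0,T)` bound on time derivatives
(Simon 1987, §8, Thm. 5 and Cor. 4; Lions 1969, Ch. 1, Thm. 5.1), in the elementary quantitative
form prepared by `TimePartitionIncrements`: a sequence `F_n : (0,T) → E` whose increments are
controlled by nonnegative rates, `‖F_n(t) - F_n(s)‖ ≤ ∫ₛᵗ g_n` with `∫₀ᵀ g_n ≤ G` uniformly in `n`,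
and whose averages over every cell `I_l^L = (l h, (l+1) h)`, `h = T/(L+1)`, of every uniform
partition of `(0,T)` converge as `n → ∞`, is a Cauchy sequence in `L³(0,T; E)`
(`exists_forall_lintegral_enorm_sub_pow_three_le_of_increments`):

  `∀ η > 0, ∃ N, ∀ n, m ≥ N, ∫₀ᵀ ‖F_n - F_m‖³ ≤ η`.

Indeed, by `lintegral_enorm_pow_three_le_of_increments` applied to `F_n - F_m` with the rate
`g_n + g_m`,
`∫₀ᵀ ‖F_n - F_m‖³ ≤ 4 h⁻² ∑_l ‖∫_{I_l} (F_n - F_m)‖³ + 4 h (2G)³`; the second term is small for `L`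
large, uniformly in `n, m`, and for that `L` the finitely many cell averages of `F_n - F_m` tend to
zero. In the Fourier-side compactness argument for smooth Navier–Stokes solutions
(De Rosa–Isett 2024, §6.1; Robinson–Rodrigo–Sadowski 2016, Thm. 4.4, Step 3) this is applied to
the coefficient functions `t ↦ û_n(t,k)`, one frequency `k` at a time, after a diagonal
extraction making all cell averages converge.

## Mathlib search

Mathlib (this pin): `Filter.eventually_atTop` on `ℕ × ℕ`, `tendsto_finset_sum`,
`ENNReal.continuous_pow`, `ENNReal.Tendsto.const_mul`, `tendsto_one_div_add_atTop_nhds_zero_nat`;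
no Aubin–Lions / Simon compactness statement (searched `Aubin`, `Simon`, `compact` + `Lp`: the
tree's `AubinLionsSlices`/`AubinLionsExtraction` are the `L²`/`H¹` cylinder versions, not this
`L¹`-in-time form).

## References

* J. Simon, *Compact sets in the space `L^p(0,T;B)`*, Ann. Mat. Pura Appl. (4) 146 (1987),
  65–96, §8, Thm. 5 and Cor. 4. [Simon1986]
* J. C. Robinson, J. L. Rodrigo, W. Sadowski, *The Three-Dimensional Navier–Stokes Equations*
  (CUP 2016), Thm. 4.4, Step 3. [RobinsonRodrigoSadowski2016]
* L. De Rosa, P. Isett, Arch. Ration. Mech. Anal. 248 (2024), Paper No. 11, §6.1. [DeRosaIsett2024]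
-/

noncomputable section

open MeasureTheory Set Filter Function
open scoped ENNReal NNReal Topology

namespace Literature.Analysis.FunctionSpaces

variable {E : Type*} [NormedAddCommGroup E] [NormedSpace ℝ E] [CompleteSpace E]

/-- `Prod.fst : ℕ × ℕ → ℕ` tends to infinity along the product order. [folklore] -/
theorem tendsto_fst_atTop_nat : Tendsto (Prod.fst : ℕ × ℕ → ℕ) atTop atTop :=
  tendsto_atTop_atTop.2 fun b => ⟨(b, b), fun _ hp => hp.1⟩

/-- `Prod.snd : ℕ × ℕ → ℕ` tends to infinity along the product order. [folklore] -/
theorem tendsto_snd_atTop_nat : Tendsto (Prod.snd : ℕ × ℕ → ℕ) atTop atTop :=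
  tendsto_atTop_atTop.2 fun b => ⟨(b, b), fun _ hp => hp.2⟩

omit [NormedSpace ℝ E] [CompleteSpace E] in
/-- Differences along a convergent sequence tend to zero jointly in the two indices:
`a n - a m → 0` as `(n, m) → ∞` in `ℕ × ℕ`. [folklore] -/
theorem tendsto_sub_atTop_prod_of_tendsto {a : ℕ → E} {c : E} (h : Tendsto a atTop (𝓝 c)) :
    Tendsto (fun p : ℕ × ℕ => a p.1 - a p.2) atTop (𝓝 0) := by
  have h1 : Tendsto (fun p : ℕ × ℕ => a p.1) atTop (𝓝 c) := h.comp tendsto_fst_atTop_nat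
  have h2 : Tendsto (fun p : ℕ × ℕ => a p.2) atTop (𝓝 c) := h.comp tendsto_snd_atTop_nat
  simpa using h1.sub h2

/-- **`L³(0,T)`-Cauchy property from controlled increments and convergent cell averages**
(the time-direction step of Simon 1987, §8, Thm. 5 / Cor. 4, quantitative form). Let
`F_n : ℝ → E` be integrable on `(0,T)` with `‖F_n(t) - F_n(s)‖ ≤ ∫ₛᵗ g_n` for `s ≤ t` in `(0,T)`,
where the rates `g_n ≥ 0` are integrable with `∫₀ᵀ g_n ≤ G` for all `n`, and assume that for
every uniform partition of `(0,T)` into `L + 1` cells `I_l = (l h, (l+1) h)`, `h = T/(L+1)`, every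
cell average `∫_{I_l} F_n` converges as `n → ∞`. Then for every `η > 0` there is `N` with
`∫₀ᵀ ‖F_n - F_m‖³ ≤ η` for all `n, m ≥ N`. Proof: `lintegral_enorm_pow_three_le_of_increments`
for `F_n - F_m` with the rate `g_n + g_m` gives
`∫₀ᵀ ‖F_n - F_m‖³ ≤ 4 h⁻² ∑_l ‖∫_{I_l} F_n - ∫_{I_l} F_m‖³ + 4 h (2G)³`; choose `L` with
`4 h (2G)³ < η/2`, then `N` from the convergence of the `L + 1` cell averages. [cite: Simon1986, §8 Thm. 5] -/
theorem exists_forall_lintegral_enorm_sub_pow_three_le_of_increments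
    {T : ℝ} (hT : 0 < T) {F : ℕ → ℝ → E} {g : ℕ → ℝ → ℝ}
    (hF : ∀ n, IntegrableOn (F n) (Ioo 0 T)) (hg : ∀ n, IntegrableOn (g n) (Ioo 0 T))
    (hg0 : ∀ n, ∀ τ ∈ Ioo 0 T, 0 ≤ g n τ)
    (hinc : ∀ n, ∀ ⦃s t : ℝ⦄, s ∈ Ioo 0 T → t ∈ Ioo 0 T → s ≤ t →
      ‖F n t - F n s‖ ≤ ∫ τ in s..t, g n τ)
    {G : ℝ} (hG : ∀ n, ∫ τ in Ioo 0 T, g n τ ≤ G)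
    (havg : ∀ L l : ℕ, l ≤ L → ∃ c : E, Tendsto
      (fun n => ∫ t in Ioo ((l : ℝ) * (T / (L + 1))) ((l + 1 : ℝ) * (T / (L + 1))), F n t)
        atTop (𝓝 c))
    {η : ℝ≥0∞} (hη : 0 < η) :
    ∃ N : ℕ, ∀ n m : ℕ, N ≤ n → N ≤ m → ∫⁻ t in Ioo 0 T, ‖F n t - F m t‖ₑ ^ 3 ≤ η := by
  have hη2 : 0 < η / 2 := ENNReal.half_pos hη.ne'
  have hG0 : 0 ≤ G := (setIntegral_nonneg measurableSet_Ioo (hg0 0)).trans (hG 0)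
  -- Step 1: the number of cells, making the rate term small uniformly in `n, m`
  have hsmall : Tendsto (fun L : ℕ => 4 * ENNReal.ofReal (T / (L + 1)) *
      ENNReal.ofReal (2 * G) ^ 3) atTop (𝓝 0) := by
    have h1 : Tendsto (fun L : ℕ => T / ((L : ℝ) + 1)) atTop (𝓝 0) := by
      simpa [div_eq_mul_one_div T] using tendsto_one_div_add_atTop_nhds_zero_nat.const_mul T
    have h2 : Tendsto (fun L : ℕ => ENNReal.ofReal (T / ((L : ℝ) + 1))) atTop (𝓝 0) := by
      simpa using ENNReal.tendsto_ofReal h1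
    have h3 := ENNReal.Tendsto.mul_const (b := ENNReal.ofReal (2 * G) ^ 3)
      (ENNReal.Tendsto.const_mul h2 (Or.inr (by norm_num : (4 : ℝ≥0∞) ≠ ⊤)))
      (Or.inr (ENNReal.pow_ne_top ENNReal.ofReal_ne_top))
    simpa using h3
  obtain ⟨L, hL⟩ := (hsmall.eventually (gt_mem_nhds hη2)).exists
  -- notation for the cells of this partition
  set h : ℝ := T / (L + 1) with hh
  have hh0 : 0 < h := by rw [hh]; positivity
  have hnh : ((L + 1 : ℕ) : ℝ) * h = T := by rw [hh]; push_cast; field_simp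
  set I : ℕ → Set ℝ := fun l => Ioo ((l : ℝ) * h) ((l + 1 : ℝ) * h) with hI
  have hIsub : ∀ l, l < L + 1 → I l ⊆ Ioo 0 T := fun l hl => Ioo_cell_subset hh0 hnh hl
  -- Step 2: the cell averages of `F n - F m` tend to zero jointly in `(n, m)`
  set a : ℕ → ℕ → E := fun n l => ∫ t in I l, F n t with ha
  have havg' : ∀ l, l < L + 1 → Tendsto (fun p : ℕ × ℕ => a p.1 l - a p.2 l) atTop (𝓝 0) := by
    intro l hl
    obtain ⟨c, hc⟩ := havg L l (Nat.lt_succ_iff.1 hl)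
    exact tendsto_sub_atTop_prod_of_tendsto hc
  set C : ℝ≥0∞ := 4 * ENNReal.ofReal ((L + 1 : ℝ) / T) ^ 2 with hC
  have hCtop : C ≠ ⊤ := ENNReal.mul_ne_top (by norm_num) (ENNReal.pow_ne_top ENNReal.ofReal_ne_top)
  have hsum : Tendsto (fun p : ℕ × ℕ => C * ∑ l ∈ Finset.range (L + 1), ‖a p.1 l - a p.2 l‖ₑ ^ 3)
      atTop (𝓝 0) := by
    have h1 : ∀ l ∈ Finset.range (L + 1),
        Tendsto (fun p : ℕ × ℕ => ‖a p.1 l - a p.2 l‖ₑ ^ 3) atTop (𝓝 0) := by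
      intro l hl
      have h2 : Tendsto (fun p : ℕ × ℕ => ‖a p.1 l - a p.2 l‖ₑ) atTop (𝓝 0) := by
        simpa using (havg' l (Finset.mem_range.1 hl)).enorm
      have h3 := ((ENNReal.continuous_pow 3).tendsto 0).comp h2
      simpa [Function.comp_def] using h3
    have h4 : Tendsto (fun p : ℕ × ℕ => ∑ l ∈ Finset.range (L + 1), ‖a p.1 l - a p.2 l‖ₑ ^ 3)
        atTop (𝓝 0) := by
      simpa using tendsto_finsetSum (Finset.range (L + 1)) h1
    simpa using ENNReal.Tendsto.const_mul h4 (Or.inr hCtop)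
  obtain ⟨N₀, hN₀⟩ := eventually_atTop.1 (hsum.eventually (gt_mem_nhds hη2))
  refine ⟨max N₀.1 N₀.2, fun n m hn hm => ?_⟩
  have hNp : N₀ ≤ (n, m) := ⟨(le_max_left _ _).trans hn, (le_max_right _ _).trans hm⟩
  -- Step 3: the increments bound for `F n - F m` with the rate `g n + g m`
  have hF' : IntegrableOn (fun t => F n t - F m t) (Ioo 0 T) := (hF n).sub (hF m)
  have hg' : IntegrableOn (fun τ => g n τ + g m τ) (Ioo 0 T) := (hg n).add (hg m)
  have hg'0 : ∀ τ ∈ Ioo 0 T, 0 ≤ g n τ + g m τ := fun τ hτ => add_nonneg (hg0 n τ hτ) (hg0 m τ hτ)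
  have hgi : ∀ k, ∀ ⦃s t : ℝ⦄, s ∈ Ioo 0 T → t ∈ Ioo 0 T → s ≤ t →
      IntervalIntegrable (g k) volume s t := by
    intro k s t hs ht hst
    have hsub : Icc s t ⊆ Ioo 0 T := fun x hx => ⟨hs.1.trans_le hx.1, hx.2.trans_lt ht.2⟩
    have h1 : IntegrableOn (g k) (uIcc s t) := by
      rw [uIcc_of_le hst]
      exact (hg k).mono_set hsub
    exact h1.intervalIntegrable
  have hinc' : ∀ ⦃s t : ℝ⦄, s ∈ Ioo 0 T → t ∈ Ioo 0 T → s ≤ t →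
      ‖(F n t - F m t) - (F n s - F m s)‖ ≤ ∫ τ in s..t, (g n τ + g m τ) := by
    intro s t hs ht hst
    rw [intervalIntegral.integral_add (hgi n hs ht hst) (hgi m hs ht hst)]
    calc ‖(F n t - F m t) - (F n s - F m s)‖ = ‖(F n t - F n s) - (F m t - F m s)‖ := by
          congr 1
          abel
      _ ≤ ‖F n t - F n s‖ + ‖F m t - F m s‖ := norm_sub_le _ _
      _ ≤ (∫ τ in s..t, g n τ) + ∫ τ in s..t, g m τ :=
          add_le_add (hinc n hs ht hst) (hinc m hs ht hst)
  have key := lintegral_enorm_pow_three_le_of_increments hT hF' hg' hg'0 hinc' L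
  -- the cell averages of the difference
  have hcellavg : ∀ l ∈ Finset.range (L + 1),
      ∫ t in Ioo ((l : ℝ) * (T / (L + 1))) ((l + 1 : ℝ) * (T / (L + 1))), (F n t - F m t) =
        a n l - a m l := by
    intro l hl
    have hl' : l < L + 1 := Finset.mem_range.1 hl
    exact integral_sub ((hF n).mono_set (hIsub l hl')) ((hF m).mono_set (hIsub l hl'))
  have hfirst : 4 * ENNReal.ofReal ((L + 1 : ℝ) / T) ^ 2 *
      ∑ l ∈ Finset.range (L + 1),
        ‖∫ t in Ioo ((l : ℝ) * (T / (L + 1))) ((l + 1 : ℝ) * (T / (L + 1))), (F n t - F m t)‖ₑ ^ 3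
        < η / 2 := by
    have := hN₀ (n, m) hNp
    rw [Finset.sum_congr rfl fun l hl => by rw [hcellavg l hl]]
    exact this
  -- the rate term
  have hrate : ENNReal.ofReal (∫ τ in Ioo 0 T, (g n τ + g m τ)) ≤ ENNReal.ofReal (2 * G) := by
    refine ENNReal.ofReal_le_ofReal ?_
    rw [integral_add (hg n) (hg m)]
    linarith [hG n, hG m]
  have hsecond : 4 * ENNReal.ofReal (T / (L + 1)) *
      ENNReal.ofReal (∫ τ in Ioo 0 T, (g n τ + g m τ)) ^ 3 < η / 2 := by
    refine lt_of_le_of_lt ?_ hL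
    gcongr
  calc ∫⁻ t in Ioo 0 T, ‖F n t - F m t‖ₑ ^ 3
      ≤ 4 * ENNReal.ofReal ((L + 1 : ℝ) / T) ^ 2 *
          ∑ l ∈ Finset.range (L + 1),
            ‖∫ t in Ioo ((l : ℝ) * (T / (L + 1))) ((l + 1 : ℝ) * (T / (L + 1))), (F n t - F m t)‖ₑ ^ 3 +
        4 * ENNReal.ofReal (T / (L + 1)) *
          ENNReal.ofReal (∫ τ in Ioo 0 T, (g n τ + g m τ)) ^ 3 := key
    _ ≤ η / 2 + η / 2 := add_le_add hfirst.le hsecond.le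
    _ = η := ENNReal.add_halves η

end Literature.Analysis.FunctionSpaces

end
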